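import Mathlib
import HarnessLib
import Summits.Ventures.LatticeQCDFlow.Scoring.RestartChainTwoProtocolAgreement
import Summits.Ventures.LatticeQCDFlow.Scoring.CPNRestartChainJarzynski

/-!
# S0-D2 AS RUN — the two-protocol agreement test of NE-MCMC with the `cpn_2d` Metropolis sweep as the
# prior on both arms: asymptotically standard normal and calibrated with NO hypothesis on the prior
# side

HONEST FRAMING: exact (Metropolis-corrected) sampling algorithms for lattice gauge theory;
figures of merit are autocorrelation/cost numbers at stated couplings and volumes; no
continuum-physics claim.

Venture `LatticeQCDFlow` (cell pub-lqcd), topic `Scoring`; FANOUT row 8 (`s0-cpn-nemc`, GEN-25).  NEW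
WORK of the cell, not a published result; no definition is introduced; nothing is cited as a fact.
Instances of `Scoring/RestartChainTwoProtocolAgreement.lean` (268) with the prior-side hypotheses
DISCHARGED by
`Scoring/CPNRestartChainJarzynski.cpn_metropolisSweep_minorised_by_cpnGibbsLaw` (269): the `cpn_2d`
Metropolis sweep (`εs, εl > 0`, scan visiting every variable) leaves `cpnGibbsLaw src tgt J c`
invariant and is minorised in one step by it.  For ANY Crooks pairs `(κF, κR, s, e, W)` on `R` and
`(κF', κR', s', e', W')` on `R'` from a finite `ν₀` with `Z₀⁻¹ ν₀ = cpnGibbsLaw` to a finite `ν₁`,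
work floors and positive asymptotic variances (ASSUMED):

* **`cpn_restart_twoProtocol_agreement_clt`** / **`_coverage`** — two INDEPENDENT correlated-restart
  runs, each driven by its own `cpn_2d` sweep (parameters `(εs, εl, l)` and `(εs', εl', l')`), from
  arbitrary starts: `(Ḡ_A,n − Ḡ'_B,m_n)/√(σ̂²_A/n + σ̂²_B/m_n) ⇒ N(0, 1)` and
  `P{|z_n| ≤ z} → (gaussianReal 0 1)[−z, z]`.

NOT CLAIMED: the construction of the CP(N−1) non-equilibrium evolutions as Crooks pairs
(hypotheses); the OR:HB prior (same one-line argument with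
`Scoring/CPNHeatBathRestartChainJarzynski.lean`); the paired test on one `cpn_2d` stream (same
argument with `Scoring/RestartChainPairedProtocolAgreement.lean`); any value of the variances; any
number of ours.
-/

noncomputable section

namespace Summit.Ventures.LatticeQCDFlow.Scoring

open MeasureTheory ProbabilityTheory Filter Finset Preorder Set
open Summit.Ventures.LatticeQCDFlow.Exactness Summit.Ventures.LatticeQCDFlow.Exactness.GeneralNCMC
open Literature.Probability.MarkovChains
open scoped ENNReal Topology

section CPN

variable {V E : Type*} [Fintype V] [Fintype E] [DecidableEq V] [DecidableEq E] {d : ℕ}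
  (src tgt : E → V) (J : EuclideanSpace ℝ (Fin (d + 2)) →L[ℝ] EuclideanSpace ℝ (Fin (d + 2)))
  (c : E → ℝ)

variable {R R' : Type*} [MeasurableSpace R] [MeasurableSpace R']
  {ν₀ ν₁ : Measure (CPNConfig V E d)}
  {κF κR : Kernel (CPNConfig V E d) R} [IsMarkovKernel κF] [IsMarkovKernel κR]
  {s e : R → CPNConfig V E d} {W : R → ℝ}
  {κF' κR' : Kernel (CPNConfig V E d) R'} [IsMarkovKernel κF'] [IsMarkovKernel κR']
  {s' e' : R' → CPNConfig V E d} {W' : R' → ℝ}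

/-- **THE TWO-PROTOCOL TEST WITH `cpn_2d` PRIORS ON BOTH ARMS, FROM EVERY PAIR OF STARTS.** -/
theorem cpn_restart_twoProtocol_agreement_clt
    {εs εl εs' εl' : ℝ} (hεs : 0 < εs) (hεl : 0 < εl) (hεs' : 0 < εs') (hεl' : 0 < εl')
    {l l' : List (V ⊕ E)} (hl : ∀ i, i ∈ l) (hl' : ∀ i, i ∈ l')
    (h : CrooksPair ν₀ ν₁ κF κR s e W) (h' : CrooksPair ν₀ ν₁ κF' κR' s' e' W')
    (hπ₀ : cpnGibbsLaw src tgt J c = (ν₀ univ)⁻¹ • ν₀)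
    {Wlo : ℝ} (hlo : ∀ ω, Wlo ≤ W ω) {Wlo' : ℝ} (hlo' : ∀ ω, Wlo' ≤ W' ω)
    (hσ : 0 < ((∫ p, (Real.exp (-W p.2) - ∫ p', Real.exp (-W p'.2) ∂(cpnGibbsLaw src tgt J c ⊗ₘ κF)) ^ 2 ∂(cpnGibbsLaw src tgt J c ⊗ₘ κF))
          + 2 * ∑' k, ∫ p, (Real.exp (-W p.2) - ∫ p', Real.exp (-W p'.2) ∂(cpnGibbsLaw src tgt J c ⊗ₘ κF))
            * (kop ((Kernel.prodMkRight R (cpnMetropolisSweep src tgt J c εs εl l))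
                ⊗ₖ (Kernel.prodMkLeft (CPNConfig V E d × R) κF)))^[k + 1]
              (fun p => Real.exp (-W p.2) - ∫ p', Real.exp (-W p'.2) ∂(cpnGibbsLaw src tgt J c ⊗ₘ κF)) p ∂(cpnGibbsLaw src tgt J c ⊗ₘ κF)))
    (hσ' : 0 < ((∫ p, (Real.exp (-W' p.2) - ∫ p', Real.exp (-W' p'.2) ∂(cpnGibbsLaw src tgt J c ⊗ₘ κF')) ^ 2
            ∂(cpnGibbsLaw src tgt J c ⊗ₘ κF'))
          + 2 * ∑' k, ∫ p, (Real.exp (-W' p.2) - ∫ p', Real.exp (-W' p'.2) ∂(cpnGibbsLaw src tgt J c ⊗ₘ κF'))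
            * (kop ((Kernel.prodMkRight R'
              (cpnMetropolisSweep src tgt J c εs' εl' l'))
                  ⊗ₖ (Kernel.prodMkLeft (CPNConfig V E d × R') κF')))^[k + 1]
              (fun p => Real.exp (-W' p.2) - ∫ p', Real.exp (-W' p'.2) ∂(cpnGibbsLaw src tgt J c ⊗ₘ κF')) p
              ∂(cpnGibbsLaw src tgt J c ⊗ₘ κF')))
    [hK : IsMarkovKernel (cpnMetropolisSweep src tgt J c εs εl l)]
    [hK' : IsMarkovKernel (cpnMetropolisSweep src tgt J c εs' εl' l')]
    (μ₀ : Measure (CPNConfig V E d × R)) [IsProbabilityMeasure μ₀] {a b : ℕ → ℕ} (ha : Tendsto a atTop atTop)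
    (hb : Tendsto b atTop atTop)
    [IsProbabilityMeasure (Kernel.trajMeasure (X := fun _ : ℕ => CPNConfig V E d × R) μ₀
          (fun n : ℕ => ((Kernel.prodMkRight R (cpnMetropolisSweep src tgt J c εs εl l))
              ⊗ₖ (Kernel.prodMkLeft (CPNConfig V E d × R) κF)).comap
            (fun h : (i : ↥(Finset.Iic n)) → CPNConfig V E d × R => h ⟨n, Finset.mem_Iic.2 le_rfl⟩)
            (measurable_pi_apply _)))]
    (μ₀' : Measure (CPNConfig V E d × R')) [IsProbabilityMeasure μ₀'] {a' b' : ℕ → ℕ}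
    (ha' : Tendsto a' atTop atTop) (hb' : Tendsto b' atTop atTop)
    [IsProbabilityMeasure (Kernel.trajMeasure (X := fun _ : ℕ => CPNConfig V E d × R') μ₀'
          (fun n : ℕ => ((Kernel.prodMkRight R'
              (cpnMetropolisSweep src tgt J c εs' εl' l'))
                  ⊗ₖ (Kernel.prodMkLeft (CPNConfig V E d × R') κF')).comap
            (fun h : (i : ↥(Finset.Iic n)) → CPNConfig V E d × R' => h ⟨n, Finset.mem_Iic.2 le_rfl⟩)
            (measurable_pi_apply _)))]
    {m : ℕ → ℕ} (hm : Tendsto m atTop atTop)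
    {Ω' : Type*} [MeasurableSpace Ω'] {P' : Measure Ω'} [IsProbabilityMeasure P'] {Z : Ω' → ℝ}
    (hZ : HasLaw Z (gaussianReal 0 1) P') :
    TendstoInDistribution (fun (n : ℕ) (ω : (ℕ → CPNConfig V E d × R) × (ℕ → CPNConfig V E d × R')) =>
        ((∑ t ∈ Finset.range n, Real.exp (-W (ω.1 t).2)) / n
            - (∑ t ∈ Finset.range (m n), Real.exp (-W' (ω.2 t).2)) / (m n))
          / Real.sqrt ((((b n * a n : ℕ) : ℝ) * replicaSEsq (fun j (x : ℕ → CPNConfig V E d × R) =>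
              (∑ i ∈ Finset.range (b n), Real.exp (-W (x (b n * j + i)).2)) / (b n)) (a n) ω.1) / n
            + (((b' (m n) * a' (m n) : ℕ) : ℝ) * replicaSEsq (fun j (x : ℕ → CPNConfig V E d × R') =>
              (∑ i ∈ Finset.range (b' (m n)), Real.exp (-W' (x (b' (m n) * j + i)).2))
              / (b' (m n))) (a' (m n)) ω.2) / (m n)))
      atTop Z (fun _ => ((Kernel.trajMeasure (X := fun _ : ℕ => CPNConfig V E d × R) μ₀
          (fun n : ℕ => ((Kernel.prodMkRight R (cpnMetropolisSweep src tgt J c εs εl l))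
              ⊗ₖ (Kernel.prodMkLeft (CPNConfig V E d × R) κF)).comap
            (fun h : (i : ↥(Finset.Iic n)) → CPNConfig V E d × R => h ⟨n, Finset.mem_Iic.2 le_rfl⟩)
            (measurable_pi_apply _)))).prod
        (Kernel.trajMeasure (X := fun _ : ℕ => CPNConfig V E d × R') μ₀'
          (fun n : ℕ => ((Kernel.prodMkRight R'
              (cpnMetropolisSweep src tgt J c εs' εl' l'))
                  ⊗ₖ (Kernel.prodMkLeft (CPNConfig V E d × R') κF')).comap
            (fun h : (i : ↥(Finset.Iic n)) → CPNConfig V E d × R' => h ⟨n, Finset.mem_Iic.2 le_rfl⟩)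
            (measurable_pi_apply _)))) P' := by
  haveI := isProbabilityMeasure_cpnGibbsLaw src tgt J c (V := V) (E := E) (d := d)
  obtain ⟨hinv, ε, hε0, -, hdoeb⟩ :=
    cpn_metropolisSweep_minorised_by_cpnGibbsLaw src tgt J c hεs hεl hl
  obtain ⟨hinv', ε', hε0', -, hdoeb'⟩ :=
    cpn_metropolisSweep_minorised_by_cpnGibbsLaw src tgt J c hεs' hεl' hl'
  exact restart_jarzynski_twoProtocol_agreement_clt (π₀ := cpnGibbsLaw src tgt J c)
    (κ₀ := cpnMetropolisSweep src tgt J c εs εl l) (κ₀' := cpnMetropolisSweep src tgt J c εs' εl' l')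
    h h' hπ₀ hinv hinv' (fun x _ hB => hdoeb x hB) hε0 (fun x _ hB => hdoeb' x hB) hε0' hlo hlo' hσ
    hσ' μ₀ ha hb μ₀' ha' hb' hm hZ

/-- **… AND IT IS CALIBRATED.** -/
theorem cpn_restart_twoProtocol_agreement_coverage
    {εs εl εs' εl' : ℝ} (hεs : 0 < εs) (hεl : 0 < εl) (hεs' : 0 < εs') (hεl' : 0 < εl')
    {l l' : List (V ⊕ E)} (hl : ∀ i, i ∈ l) (hl' : ∀ i, i ∈ l')
    (h : CrooksPair ν₀ ν₁ κF κR s e W) (h' : CrooksPair ν₀ ν₁ κF' κR' s' e' W')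
    (hπ₀ : cpnGibbsLaw src tgt J c = (ν₀ univ)⁻¹ • ν₀)
    {Wlo : ℝ} (hlo : ∀ ω, Wlo ≤ W ω) {Wlo' : ℝ} (hlo' : ∀ ω, Wlo' ≤ W' ω)
    (hσ : 0 < ((∫ p, (Real.exp (-W p.2) - ∫ p', Real.exp (-W p'.2) ∂(cpnGibbsLaw src tgt J c ⊗ₘ κF)) ^ 2 ∂(cpnGibbsLaw src tgt J c ⊗ₘ κF))
          + 2 * ∑' k, ∫ p, (Real.exp (-W p.2) - ∫ p', Real.exp (-W p'.2) ∂(cpnGibbsLaw src tgt J c ⊗ₘ κF))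
            * (kop ((Kernel.prodMkRight R (cpnMetropolisSweep src tgt J c εs εl l))
                ⊗ₖ (Kernel.prodMkLeft (CPNConfig V E d × R) κF)))^[k + 1]
              (fun p => Real.exp (-W p.2) - ∫ p', Real.exp (-W p'.2) ∂(cpnGibbsLaw src tgt J c ⊗ₘ κF)) p ∂(cpnGibbsLaw src tgt J c ⊗ₘ κF)))
    (hσ' : 0 < ((∫ p, (Real.exp (-W' p.2) - ∫ p', Real.exp (-W' p'.2) ∂(cpnGibbsLaw src tgt J c ⊗ₘ κF')) ^ 2
            ∂(cpnGibbsLaw src tgt J c ⊗ₘ κF'))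
          + 2 * ∑' k, ∫ p, (Real.exp (-W' p.2) - ∫ p', Real.exp (-W' p'.2) ∂(cpnGibbsLaw src tgt J c ⊗ₘ κF'))
            * (kop ((Kernel.prodMkRight R'
              (cpnMetropolisSweep src tgt J c εs' εl' l'))
                  ⊗ₖ (Kernel.prodMkLeft (CPNConfig V E d × R') κF')))^[k + 1]
              (fun p => Real.exp (-W' p.2) - ∫ p', Real.exp (-W' p'.2) ∂(cpnGibbsLaw src tgt J c ⊗ₘ κF')) p
              ∂(cpnGibbsLaw src tgt J c ⊗ₘ κF')))
    [hK : IsMarkovKernel (cpnMetropolisSweep src tgt J c εs εl l)]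
    [hK' : IsMarkovKernel (cpnMetropolisSweep src tgt J c εs' εl' l')]
    (μ₀ : Measure (CPNConfig V E d × R)) [IsProbabilityMeasure μ₀] {a b : ℕ → ℕ} (ha : Tendsto a atTop atTop)
    (hb : Tendsto b atTop atTop)
    [IsProbabilityMeasure (Kernel.trajMeasure (X := fun _ : ℕ => CPNConfig V E d × R) μ₀
          (fun n : ℕ => ((Kernel.prodMkRight R (cpnMetropolisSweep src tgt J c εs εl l))
              ⊗ₖ (Kernel.prodMkLeft (CPNConfig V E d × R) κF)).comap
            (fun h : (i : ↥(Finset.Iic n)) → CPNConfig V E d × R => h ⟨n, Finset.mem_Iic.2 le_rfl⟩)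
            (measurable_pi_apply _)))]
    (μ₀' : Measure (CPNConfig V E d × R')) [IsProbabilityMeasure μ₀'] {a' b' : ℕ → ℕ}
    (ha' : Tendsto a' atTop atTop) (hb' : Tendsto b' atTop atTop)
    [IsProbabilityMeasure (Kernel.trajMeasure (X := fun _ : ℕ => CPNConfig V E d × R') μ₀'
          (fun n : ℕ => ((Kernel.prodMkRight R'
              (cpnMetropolisSweep src tgt J c εs' εl' l'))
                  ⊗ₖ (Kernel.prodMkLeft (CPNConfig V E d × R') κF')).comap
            (fun h : (i : ↥(Finset.Iic n)) → CPNConfig V E d × R' => h ⟨n, Finset.mem_Iic.2 le_rfl⟩)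
            (measurable_pi_apply _)))]
    {m : ℕ → ℕ} (hm : Tendsto m atTop atTop) {z : ℝ} (hz : 0 < z) :
    Tendsto (fun n : ℕ => (((Kernel.trajMeasure (X := fun _ : ℕ => CPNConfig V E d × R) μ₀
          (fun n : ℕ => ((Kernel.prodMkRight R (cpnMetropolisSweep src tgt J c εs εl l))
              ⊗ₖ (Kernel.prodMkLeft (CPNConfig V E d × R) κF)).comap
            (fun h : (i : ↥(Finset.Iic n)) → CPNConfig V E d × R => h ⟨n, Finset.mem_Iic.2 le_rfl⟩)
            (measurable_pi_apply _)))).prod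
        (Kernel.trajMeasure (X := fun _ : ℕ => CPNConfig V E d × R') μ₀'
          (fun n : ℕ => ((Kernel.prodMkRight R'
              (cpnMetropolisSweep src tgt J c εs' εl' l'))
                  ⊗ₖ (Kernel.prodMkLeft (CPNConfig V E d × R') κF')).comap
            (fun h : (i : ↥(Finset.Iic n)) → CPNConfig V E d × R' => h ⟨n, Finset.mem_Iic.2 le_rfl⟩)
            (measurable_pi_apply _)))).real
      {ω | |((∑ t ∈ Finset.range n, Real.exp (-W (ω.1 t).2)) / n
            - (∑ t ∈ Finset.range (m n), Real.exp (-W' (ω.2 t).2)) / (m n))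
          / Real.sqrt ((((b n * a n : ℕ) : ℝ) * replicaSEsq (fun j (x : ℕ → CPNConfig V E d × R) =>
              (∑ i ∈ Finset.range (b n), Real.exp (-W (x (b n * j + i)).2)) / (b n)) (a n) ω.1) / n
            + (((b' (m n) * a' (m n) : ℕ) : ℝ) * replicaSEsq (fun j (x : ℕ → CPNConfig V E d × R') =>
              (∑ i ∈ Finset.range (b' (m n)), Real.exp (-W' (x (b' (m n) * j + i)).2))
              / (b' (m n))) (a' (m n)) ω.2) / (m n))| ≤ z})
      atTop (𝓝 ((gaussianReal 0 1).real (Set.Icc (-z) z))) := by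
  haveI := isProbabilityMeasure_cpnGibbsLaw src tgt J c (V := V) (E := E) (d := d)
  obtain ⟨hinv, ε, hε0, -, hdoeb⟩ :=
    cpn_metropolisSweep_minorised_by_cpnGibbsLaw src tgt J c hεs hεl hl
  obtain ⟨hinv', ε', hε0', -, hdoeb'⟩ :=
    cpn_metropolisSweep_minorised_by_cpnGibbsLaw src tgt J c hεs' hεl' hl'
  exact restart_jarzynski_twoProtocol_agreement_coverage (π₀ := cpnGibbsLaw src tgt J c)
    (κ₀ := cpnMetropolisSweep src tgt J c εs εl l) (κ₀' := cpnMetropolisSweep src tgt J c εs' εl' l')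
    h h' hπ₀ hinv hinv' (fun x _ hB => hdoeb x hB) hε0 (fun x _ hB => hdoeb' x hB) hε0' hlo hlo' hσ
    hσ' μ₀ ha hb μ₀' ha' hb' hm hz

end CPN

end Summit.Ventures.LatticeQCDFlow.Scoring

end
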